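import Mathlib
import HarnessLib
import Summits.AtomisticToContinuum.Crystallization.Theorems.PricedLinkCensusSoftFourRingsThreeTriQuad
import Summits.AtomisticToContinuum.Crystallization.Theorems.PricedLinkCensusSoftFourRingsFacetCorner

/-!
# The lone gap of a three-triangle fan is wider than any facet corner

Route `PricedLinkCensus`, item `SoftFourRings` (stmt-AtomisticToContinuum-14234), evidence
`softrings-search.md` §12.2.  At a site `v` whose four link neighbours `w₀ ∼ w₁ ∼ w₂ ∼ w₃` form a
bonded path (three consecutive bond triangles), the three triangle corners are each `≤ g₁ = arccos K`
(`corner_cos_lower`, `K = (cb − ca²)/(1 − ca²)`, `71.9°` at `η = 1/100`) and the path winds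
monotonically (`fin_four_path_dihedral`), so the remaining gap between `w₃` and `w₀` is
`≥ 2π − 3 g₁` (`144.3°`): the tangent directions at `v` towards `w₀` and `w₃` have cosine
`≤ cos (3 g₁) = 4K³ − 3K ≈ −0.812` (`four_sorted_fan_gap`, `four_fan_gap`, `three_fan_gap`).
Since every facet corner of the twelve directions has cosine `≥ −0.73` (`FacetCorner`, conditional
on Tammes-13), NO FACET of the hull contains `v`, `w₀` and `w₃` together
(`no_facet_through_three_fan_one_percent`): the lone gap of a three-triangle vertex is crossed by a
further (non-bond) hull edge at `v`.
-/

namespace Summit.AtomisticToContinuum.Crystallization.Theorems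

open Real RealInnerProductSpace Literature.Geometry.DiscreteGeometry

/-- **The fan gap (sorted form).**  `π/3 < g₀`, `2g₀ ≤ π`, `0 ≤ g₁ < 2g₀`, `3g₁ ≤ 2π`; sorted
angles `t₀ < ⋯ < t₃` in `(−π, π]`, pairwise `cos (t i − t j) ≤ cos g₀`; an injective placement
`q` with the label pairs `{0,1}, {1,2}, {2,3}` at circular distance `≤ g₁`.  Then the labels `0`
and `3` are at circular distance `≥ 2π − 3g₁`: `cos (t (q 0) − t (q 3)) ≤ cos (3 g₁)`. [folklore] -/
theorem four_sorted_fan_gap {g₀ g₁ : ℝ} (hg₀ : π / 3 < g₀) (h2g₀ : 2 * g₀ ≤ π)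
    (hg₁0 : 0 ≤ g₁) (hg₁₀ : g₁ < 2 * g₀) (h3 : 3 * g₁ ≤ 2 * π) (t : Fin 4 → ℝ)
    (hmono : StrictMono t) (hlo : -π < t 0) (hhi : t 3 ≤ π)
    (hsep : ∀ i j, i ≠ j → cos (t i - t j) ≤ cos g₀) (q : Fin 4 → Fin 4)
    (hq : Function.Injective q) (hb01 : cos g₁ ≤ cos (t (q 1) - t (q 0)))
    (hb12 : cos g₁ ≤ cos (t (q 2) - t (q 1))) (hb23 : cos g₁ ≤ cos (t (q 3) - t (q 2))) :
    cos (t (q 0) - t (q 3)) ≤ cos (3 * g₁) := by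
  have hπ := pi_pos
  obtain ⟨g1lo, g2lo, g3lo, g30hi, hd02, hd13⟩ := four_sorted_gaps hg₀ h2g₀ t hmono hlo hhi hsep
  have hg₁π : g₁ ≤ π := by linarith
  -- diagonals are too long to be path steps
  have hcos2 : cos (2 * g₀) < cos g₁ := cos_lt_cos_of_nonneg_of_le_pi hg₁0 h2g₀ hg₁₀
  have nb02 : ¬ cos g₁ ≤ cos (t 2 - t 0) := fun h => by linarith
  have nb20 : ¬ cos g₁ ≤ cos (t 0 - t 2) := fun h => by rw [cos_sub_rev] at h; linarith
  have nb13 : ¬ cos g₁ ≤ cos (t 3 - t 1) := fun h => by linarith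
  have nb31 : ¬ cos g₁ ≤ cos (t 1 - t 3) := fun h => by rw [cos_sub_rev] at h; linarith
  have adj_of_bond : ∀ a b : Fin 4, a ≠ b → cos g₁ ≤ cos (t b - t a) →
      (b = a + 1 ∨ a = b + 1) := by
    intro a b hab h
    rcases fin_four_adj_or_diag a b hab with h' | ⟨rfl, rfl⟩ | ⟨rfl, rfl⟩ | ⟨rfl, rfl⟩ |
      ⟨rfl, rfl⟩
    · exact h'
    · exact absurd h nb02
    · exact absurd h nb20
    · exact absurd h nb13
    · exact absurd h nb31
  have c01 := adj_of_bond (q 0) (q 1) (hq.ne (by decide)) hb01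
  have c12 := adj_of_bond (q 1) (q 2) (hq.ne (by decide)) hb12
  have c23 := adj_of_bond (q 2) (q 3) (hq.ne (by decide)) hb23
  -- the four cyclic gaps, indexed by their starting position
  set gap : Fin 4 → ℝ := ![t 1 - t 0, t 2 - t 1, t 3 - t 2, t 0 - t 3 + 2 * π] with hgap
  have hsum : gap 0 + gap 1 + gap 2 + gap 3 = 2 * π := by
    simp only [hgap, Matrix.cons_val]; ring
  have hgap_lt : ∀ a : Fin 4, gap a < π := by
    intro a
    fin_cases a <;> simp [hgap] <;> linarith
  have hgap_cos : ∀ a : Fin 4, cos (gap a) = cos (t (a + 1) - t a) := by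
    intro a
    fin_cases a <;> simp [hgap]
  have hB : ∀ (a : Fin 4) (G : ℝ), 0 ≤ G → G ≤ π → cos G ≤ cos (t (a + 1) - t a) →
      gap a ≤ G := by
    intro a G hG0 hGπ h
    rw [← hgap_cos a] at h
    exact le_of_cos_le_cos' (hgap_lt a).le hG0 h
  have hbij : Function.Bijective q := Finite.injective_iff_bijective.mp hq
  have hsumq : gap (q 0) + gap (q 1) + gap (q 2) + gap (q 3) = 2 * π := by
    have h := Equiv.sum_comp (Equiv.ofBijective q hbij) gap
    simp only [Equiv.ofBijective_apply, Fin.sum_univ_four] at h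
    rw [h, hsum]
  -- a gap `≥ 2π − 3g₁` (and `< π`) has cosine `≤ cos (3g₁)`
  have hC : ∀ a : Fin 4, 2 * π - 3 * g₁ ≤ gap a → cos (gap a) ≤ cos (3 * g₁) := by
    intro a ha
    rw [show 3 * g₁ = 2 * π - (2 * π - 3 * g₁) by ring, cos_two_pi_sub]
    exact cos_le_cos_of_nonneg_of_le_pi (by linarith) (hgap_lt a).le ha
  rcases fin_four_path_dihedral (q 0) (q 1) (q 2) (q 3) (hq.ne (by decide)) (hq.ne (by decide))
    c01 c12 c23 with ⟨h01, h12, h23, h30⟩ | ⟨h10, h21, h32, h03⟩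
  · have b0 : gap (q 0) ≤ g₁ := hB _ _ hg₁0 hg₁π (by rw [← h01]; exact hb01)
    have b1 : gap (q 1) ≤ g₁ := hB _ _ hg₁0 hg₁π (by rw [← h12]; exact hb12)
    have b2 : gap (q 2) ≤ g₁ := hB _ _ hg₁0 hg₁π (by rw [← h23]; exact hb23)
    have h := hC (q 3) (by linarith)
    rwa [hgap_cos, ← h30] at h
  · have b0 : gap (q 1) ≤ g₁ :=
      hB _ _ hg₁0 hg₁π (by rw [← h10, cos_sub_rev]; exact hb01)
    have b1 : gap (q 2) ≤ g₁ :=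
      hB _ _ hg₁0 hg₁π (by rw [← h21, cos_sub_rev]; exact hb12)
    have b2 : gap (q 3) ≤ g₁ :=
      hB _ _ hg₁0 hg₁π (by rw [← h32, cos_sub_rev]; exact hb23)
    have h := hC (q 0) (by linarith)
    rwa [hgap_cos, ← h03, cos_sub_rev] at h

/-- **The fan gap.**  Four angles `θ k ∈ (−π, π]`, pairwise separated
(`cos (θ i − θ j) ≤ cos g₀`), with `{0,1}, {1,2}, {2,3}` at circular distance `≤ g₁`
(`cos g₁ ≤ cos (θ (k+1) − θ k)`), `π/3 < g₀`, `2g₀ ≤ π`, `0 ≤ g₁ < 2g₀`, `3g₁ ≤ 2π`: then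
`cos (θ 0 − θ 3) ≤ cos (3 g₁)`. [folklore] -/
theorem four_fan_gap {g₀ g₁ : ℝ} (hg₀ : π / 3 < g₀) (h2g₀ : 2 * g₀ ≤ π) (hg₁0 : 0 ≤ g₁)
    (hg₁₀ : g₁ < 2 * g₀) (h3 : 3 * g₁ ≤ 2 * π) (θ : Fin 4 → ℝ) (hθ : ∀ k, -π < θ k ∧ θ k ≤ π)
    (hsep : ∀ i j, i ≠ j → cos (θ i - θ j) ≤ cos g₀) (hb01 : cos g₁ ≤ cos (θ 1 - θ 0))
    (hb12 : cos g₁ ≤ cos (θ 2 - θ 1)) (hb23 : cos g₁ ≤ cos (θ 3 - θ 2)) :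
    cos (θ 0 - θ 3) ≤ cos (3 * g₁) := by
  have hcos1 : cos g₀ < 1 := by
    have := cos_lt_cos_of_nonneg_of_le_pi (le_refl 0) (by linarith) (by linarith : (0 : ℝ) < g₀)
    rwa [cos_zero] at this
  have hθinj : Function.Injective θ := by
    intro i j hij
    by_contra hne
    have := hsep i j hne
    rw [hij, sub_self, cos_zero] at this
    linarith
  have hAcard : (Finset.univ.image θ).card = 4 := by
    rw [Finset.card_image_of_injective _ hθinj, Finset.card_univ, Fintype.card_fin]
  let e := (Finset.univ.image θ).orderEmbOfFin hAcard
  have hmem : ∀ i, ∃ k, e k = θ i := by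
    intro i
    have hi : θ i ∈ Set.range e := by
      rw [Finset.range_orderEmbOfFin, Finset.coe_image]
      exact ⟨i, by simp, rfl⟩
    exact hi
  choose q hq using hmem
  have hqinj : Function.Injective q := by
    intro a b hab
    apply hθinj
    rw [← hq a, ← hq b, hab]
  have hmem' : ∀ k, ∃ i, θ i = e k := by
    intro k
    have := (Finset.univ.image θ).orderEmbOfFin_mem hAcard k
    rw [Finset.mem_image] at this
    obtain ⟨i, -, hi⟩ := this
    exact ⟨i, hi⟩
  have h := four_sorted_fan_gap hg₀ h2g₀ hg₁0 hg₁₀ h3 (fun k => e k) e.strictMono ?_ ?_ ?_ q hqinj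
    ?_ ?_ ?_
  · have h' : cos (e (q 0) - e (q 3)) ≤ cos (3 * g₁) := h
    rwa [hq, hq] at h'
  · show -π < e 0
    obtain ⟨i, hi⟩ := hmem' 0
    rw [← hi]; exact (hθ i).1
  · show e 3 ≤ π
    obtain ⟨i, hi⟩ := hmem' 3
    rw [← hi]; exact (hθ i).2
  · intro a b hab
    obtain ⟨i, hi⟩ := hmem' a
    obtain ⟨j, hj⟩ := hmem' b
    have hne : i ≠ j := by
      rintro rfl
      exact hab (e.injective (hi.symm.trans hj))
    show cos (e a - e b) ≤ cos g₀
    rw [← hi, ← hj]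
    exact hsep i j hne
  · show cos g₁ ≤ cos (e (q 1) - e (q 0))
    rw [hq, hq]; exact hb01
  · show cos g₁ ≤ cos (e (q 2) - e (q 1))
    rw [hq, hq]; exact hb12
  · show cos g₁ ≤ cos (e (q 3) - e (q 2))
    rw [hq, hq]; exact hb23

/-- **The lone gap of a three-triangle fan, on the sphere** (general constants; hypotheses on
`ca, cb, K` as in `no_three_triangles_quad`, plus `−1/2 ≤ K` for `3 arccos K ≤ 2π`).  `v` unit;
four unit directions `w k` in the window `cb ≤ ⟪v, w k⟫ ≤ ca`, pairwise `⟪w i, w j⟫ ≤ ca`, bonded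
along the path `w₀ ∼ w₁ ∼ w₂ ∼ w₃` (`cb ≤ ⟪w k, w (k+1)⟫`).  Then the tangent directions at `v`
towards `w₀` and `w₃` satisfy `⟪w₀ − ⟪v,w₀⟫v, w₃ − ⟪v,w₃⟫v⟫ ≤ (4K³ − 3K)·‖·‖·‖·‖`
(`cos ≤ cos (3 arccos K)`). [folklore] -/
theorem three_fan_gap {ca cb K : ℝ} (hcb0 : 0 < cb) (hcba : cb ≤ ca) (hca1 : ca < 1)
    (hsq : ca ^ 2 < cb) (hK : K * (1 - ca ^ 2) = cb - ca ^ 2)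
    (hKs : K ^ 2 * ca ^ 2 * (1 - cb ^ 2) ≤ cb ^ 2 * (1 - ca ^ 2))
    (hσ : (ca - cb ^ 2) / (1 - ca ^ 2) < 1 / 2)
    (hσK : 2 * ((ca - cb ^ 2) / (1 - ca ^ 2)) ^ 2 - 1 < K) (hKhalf : -1 / 2 ≤ K)
    {v : EuclideanSpace ℝ (Fin 3)} (hv : ‖v‖ = 1) (w : Fin 4 → EuclideanSpace ℝ (Fin 3))
    (hw : ∀ k, ‖w k‖ = 1) (hvw : ∀ k, cb ≤ ⟪v, w k⟫ ∧ ⟪v, w k⟫ ≤ ca)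
    (hsep : ∀ i j, i ≠ j → ⟪w i, w j⟫ ≤ ca)
    (h01 : cb ≤ ⟪w 0, w 1⟫) (h12 : cb ≤ ⟪w 1, w 2⟫) (h23 : cb ≤ ⟪w 2, w 3⟫) :
    ⟪w 0 - ⟪v, w 0⟫ • v, w 3 - ⟪v, w 3⟫ • v⟫ ≤
      (4 * K ^ 3 - 3 * K) * (‖w 0 - ⟪v, w 0⟫ • v‖ * ‖w 3 - ⟪v, w 3⟫ • v‖) := by
  set σ₁ := (ca - cb ^ 2) / (1 - ca ^ 2) with hσ₁
  have hca0 : 0 < ca := hcb0.trans_le hcba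
  have h1ca : 0 < 1 - ca ^ 2 := by nlinarith
  have hσ0 : 0 ≤ σ₁ := div_nonneg (by nlinarith) h1ca.le
  have hK1 : K ≤ 1 := by
    by_contra h
    have h' : 1 < K := not_le.mp h
    have := mul_lt_mul_of_pos_right h' h1ca
    rw [hK, one_mul] at this
    linarith
  -- tangent polar coordinates
  obtain ⟨ρ, θ, hρ0, hρsq, hθ, hinner⟩ := tangent_polar hv w hw
  have hcb_le : ∀ k, cb ≤ ⟪v, w k⟫ := fun k => (hvw k).1
  have hc_le : ∀ k, ⟪v, w k⟫ ≤ ca := fun k => (hvw k).2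
  have hc0 : ∀ k, 0 ≤ ⟪v, w k⟫ := fun k => hcb0.le.trans (hcb_le k)
  have hρρlo : ∀ i j, 1 - ca ^ 2 ≤ ρ i * ρ j := by
    intro i j
    have hi : 1 - ca ^ 2 ≤ ρ i ^ 2 := by rw [hρsq]; nlinarith [hc_le i, hc0 i]
    have hj : 1 - ca ^ 2 ≤ ρ j ^ 2 := by rw [hρsq]; nlinarith [hc_le j, hc0 j]
    have hsq2 : (1 - ca ^ 2) ^ 2 ≤ (ρ i * ρ j) ^ 2 := by
      rw [mul_pow, sq (1 - ca ^ 2)]; exact mul_le_mul hi hj h1ca.le (sq_nonneg _)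
    exact (pow_le_pow_iff_left₀ h1ca.le (mul_nonneg (hρ0 _) (hρ0 _)) two_ne_zero).1 hsq2
  have hsepθ : ∀ i j, i ≠ j → cos (θ i - θ j) ≤ σ₁ := by
    intro i j hij
    have h := hsep i j hij
    rw [hinner] at h
    have hcc : cb ^ 2 ≤ ⟪v, w i⟫ * ⟪v, w j⟫ := by nlinarith [hcb_le i, hcb_le j, hcb0]
    have hKK : ρ i * ρ j * cos (θ i - θ j) ≤ ca - cb ^ 2 := by linarith
    rcases le_or_gt (cos (θ i - θ j)) 0 with hneg | hpos
    · exact hneg.trans hσ0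
    · rw [hσ₁, le_div_iff₀ h1ca]
      calc cos (θ i - θ j) * (1 - ca ^ 2) ≤ cos (θ i - θ j) * (ρ i * ρ j) :=
            mul_le_mul_of_nonneg_left (hρρlo i j) hpos.le
        _ ≤ ca - cb ^ 2 := by linarith
  have hbondθ : ∀ i j, cb ≤ ⟪w i, w j⟫ → K ≤ cos (θ i - θ j) := by
    intro i j hb
    rw [hinner, add_comm] at hb
    exact corner_cos_lower hcb0 hca1 hsq hK hKs (hcb_le i) (hc_le i) (hc_le j) (hρ0 _) (hρsq i)
      (hρ0 _) (hρsq j) hb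
  -- the angles
  set g₀ := arccos σ₁ with hg₀
  set g₁ := arccos K with hg₁
  have hσ1 : σ₁ ≤ 1 := by linarith
  have hcg₀ : cos g₀ = σ₁ := cos_arccos (by linarith) hσ1
  have hcg₁ : cos g₁ = K := cos_arccos (by linarith) hK1
  have hπ3 : π / 3 < g₀ := by
    have : arccos (1 / 2) = π / 3 :=
      arccos_eq_of_eq_cos (by positivity) (by linarith [pi_pos]) cos_pi_div_three.symm
    rw [hg₀, ← this]
    exact arccos_lt_arccos (by linarith) hσ (by norm_num)
  have h2g₀ : 2 * g₀ ≤ π := by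
    have := arccos_le_pi_div_two.2 hσ0
    rw [← hg₀] at this; linarith
  have hg₁0 : 0 ≤ g₁ := arccos_nonneg K
  have hg₁π : g₁ ≤ π := arccos_le_pi K
  have hg₁₀ : g₁ < 2 * g₀ := by
    by_contra h
    have h' : 2 * g₀ ≤ g₁ := not_lt.mp h
    have := cos_le_cos_of_nonneg_of_le_pi (by linarith [arccos_nonneg σ₁]) hg₁π h'
    rw [hcg₁, cos_two_mul, hcg₀] at this
    linarith
  have h3 : 3 * g₁ ≤ 2 * π := by
    have h23 : arccos (-1 / 2) = 2 * π / 3 := by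
      have hc : cos (2 * π / 3) = -1 / 2 := by
        rw [show 2 * π / 3 = π - π / 3 by ring, cos_pi_sub, cos_pi_div_three]; norm_num
      exact arccos_eq_of_eq_cos (by positivity) (by linarith [pi_pos]) hc.symm
    have := arccos_le_arccos hKhalf
    rw [h23, ← hg₁] at this
    linarith
  have hgap := four_fan_gap hπ3 h2g₀ hg₁0 hg₁₀ h3 θ hθ
    (fun i j hij => by rw [hcg₀]; exact hsepθ i j hij)
    (by rw [hcg₁, cos_sub_rev]; exact hbondθ 0 1 h01)
    (by rw [hcg₁, cos_sub_rev]; exact hbondθ 1 2 h12)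
    (by rw [hcg₁, cos_sub_rev]; exact hbondθ 2 3 h23)
  have hcos3 : cos (3 * g₁) = 4 * K ^ 3 - 3 * K := by rw [cos_three_mul, hcg₁]
  rw [hcos3] at hgap
  -- back to vectors: `⟪w₀ − p₀v, w₃ − p₃v⟫ = ρ₀ρ₃ cos(θ₀ − θ₃)` and `‖w_k − p_k v‖ = ρ_k`
  have hvv : ⟪v, v⟫ = 1 := by rw [real_inner_self_eq_norm_sq, hv]; norm_num
  have htt : ⟪w 0 - ⟪v, w 0⟫ • v, w 3 - ⟪v, w 3⟫ • v⟫ = ρ 0 * ρ 3 * cos (θ 0 - θ 3) := by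
    rw [inner_sub_left, inner_sub_right, inner_sub_right, real_inner_smul_left,
      real_inner_smul_right, real_inner_smul_left, real_inner_smul_right, hvv, hinner 0 3,
      real_inner_comm v (w 0)]
    ring
  have hnorm : ∀ k, ‖w k - ⟪v, w k⟫ • v‖ = ρ k := by
    intro k
    have h2 : ‖w k - ⟪v, w k⟫ • v‖ ^ 2 = ρ k ^ 2 := by
      have hkk : ⟪w k, w k⟫ = 1 := by rw [real_inner_self_eq_norm_sq, hw k]; norm_num
      rw [← real_inner_self_eq_norm_sq, inner_sub_left, inner_sub_right, inner_sub_right,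
        real_inner_smul_left, real_inner_smul_right, real_inner_smul_left, real_inner_smul_right,
        hvv, hkk, real_inner_comm v (w k), hρsq k]
      ring
    exact (pow_left_inj₀ (norm_nonneg _) (hρ0 k) two_ne_zero).1 h2
  rw [htt, hnorm, hnorm]
  have hρρ := mul_nonneg (hρ0 0) (hρ0 3)
  nlinarith [mul_le_mul_of_nonneg_left hgap hρρ]

/-- **No facet through a three-triangle fan** (`η = 1/100`, conditional on Tammes-13).  For at
least twelve unit vectors `X` pairwise at inner product `≤ ca = 1 − 1/(2·(101/100)²)`, a site
`v ∈ X` with four link directions `w k ∈ X` in the window `cb = 1 − (101/100)²/2 ≤ ⟪v, w k⟫`,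
pairwise separated and bonded along the path `w₀ ∼ w₁ ∼ w₂ ∼ w₃`, and a supporting functional
`c` (`⟪c, ·⟫ ≤ 1` on `X`): `v`, `w₀`, `w₃` are not all tight for `c` — the fan gap has cosine
`≤ 4K³ − 3K < −0.81` while every facet corner has cosine `≥ −0.73`.
[cite: MusinTarasov2012, Theorem 1] -/
theorem no_facet_through_three_fan_one_percent (hT : musinTarasov2012_tammes_thirteen)
    {X : Finset (EuclideanSpace ℝ (Fin 3))} (hX1 : ∀ y ∈ X, ‖y‖ = 1) (hcard : 12 ≤ X.card)
    (hsepX : ∀ u ∈ X, ∀ u' ∈ X, u ≠ u' → ⟪u, u'⟫ ≤ 1 - 1 / (2 * (101 / 100 : ℝ) ^ 2))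
    {v : EuclideanSpace ℝ (Fin 3)} (hv : v ∈ X) (w : Fin 4 → EuclideanSpace ℝ (Fin 3))
    (hwX : ∀ k, w k ∈ X) (hwinj : Function.Injective w) (hwv : ∀ k, w k ≠ v)
    (hvw : ∀ k, 1 - (101 / 100 : ℝ) ^ 2 / 2 ≤ ⟪v, w k⟫)
    (h01 : 1 - (101 / 100 : ℝ) ^ 2 / 2 ≤ ⟪w 0, w 1⟫)
    (h12 : 1 - (101 / 100 : ℝ) ^ 2 / 2 ≤ ⟪w 1, w 2⟫)
    (h23 : 1 - (101 / 100 : ℝ) ^ 2 / 2 ≤ ⟪w 2, w 3⟫) {c : EuclideanSpace ℝ (Fin 3)}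
    (hc : ∀ y ∈ X, ⟪c, y⟫ ≤ 1) (hcv : ⟪c, v⟫ = 1) (hc0 : ⟪c, w 0⟫ = 1) (hc3 : ⟪c, w 3⟫ = 1) :
    False := by
  have hvn : ‖v‖ = 1 := hX1 v hv
  have hwin : ∀ k, 1 - (101 / 100 : ℝ) ^ 2 / 2 ≤ ⟪v, w k⟫ ∧
      ⟪v, w k⟫ ≤ 1 - 1 / (2 * (101 / 100 : ℝ) ^ 2) :=
    fun k => ⟨hvw k, hsepX v hv (w k) (hwX k) (hwv k).symm⟩
  have hsep : ∀ i j, i ≠ j → ⟪w i, w j⟫ ≤ 1 - 1 / (2 * (101 / 100 : ℝ) ^ 2) :=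
    fun i j hij => hsepX (w i) (hwX i) (w j) (hwX j) (fun h => hij (hwinj h))
  -- the fan gap: `cos ≤ 4K³ − 3K`
  have hgap := three_fan_gap (ca := 1 - 1 / (2 * (101 / 100 : ℝ) ^ 2))
    (cb := 1 - (101 / 100 : ℝ) ^ 2 / 2) (K := 478679849399 / 1540200000000) (by norm_num)
    (by norm_num) (by norm_num) (by norm_num) (by norm_num) (by norm_num) (by norm_num)
    (by norm_num) (by norm_num) hvn w (fun k => hX1 _ (hwX k)) hwin hsep h01 h12 h23
  -- the corner cap: `cos ≥ −0.73`
  have hcap := facet_corner_cos_ge_one_percent hT hX1 hcard hsepX hc hv (hwX 0) (hwX 3) (hwv 0)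
    (hwv 3) hcv hc0 hc3
  -- the tangent vectors are nonzero
  have hpos : ∀ k, 0 < ‖w k - ⟪v, w k⟫ • v‖ := by
    intro k
    have hvv : ⟪v, v⟫ = 1 := by rw [real_inner_self_eq_norm_sq, hvn]; norm_num
    have hkk : ⟪w k, w k⟫ = 1 := by rw [real_inner_self_eq_norm_sq, hX1 _ (hwX k)]; norm_num
    have h2 : ‖w k - ⟪v, w k⟫ • v‖ ^ 2 = 1 - ⟪v, w k⟫ ^ 2 := by
      rw [← real_inner_self_eq_norm_sq, inner_sub_left, inner_sub_right, inner_sub_right,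
        real_inner_smul_left, real_inner_smul_right, real_inner_smul_left, real_inner_smul_right,
        hvv, hkk, real_inner_comm (w k) v]
      ring
    have hlt : ⟪v, w k⟫ ^ 2 < 1 := by
      have := (hwin k).1
      have := (hwin k).2
      nlinarith
    have : 0 < ‖w k - ⟪v, w k⟫ • v‖ ^ 2 := by rw [h2]; linarith
    exact lt_of_le_of_ne (norm_nonneg _) (fun h => by rw [← h] at this; norm_num at this)
  have hprod := mul_pos (hpos 0) (hpos 3)
  norm_num at hgap hcap
  nlinarith [hgap, hcap, hprod]

end Summit.AtomisticToContinuum.Crystallization.Theorems
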